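import Summits.BirchSwinnertonDyer.Rank1Residual.Additive.CyclotomicTowerSignedSelmer
import Summits.BirchSwinnertonDyer.Rank1Residual.Additive.CyclotomicTowerSignedLocalIntersection
import HarnessLib

/-!
# The local layer indices `[K_{n,v} : K_{m,v}]` of the tower `Gal(K̄/K₀·K_n^κ)` divide `p^{n−m}` —
# the hypothesis `hidx` of `CyclotomicTowerSignedLocalIntersection.lean` DISCHARGED for cc-typer-6's
# tower `towerSubgroup κ K₀`; hence Prop. 8.12 ii) (first identity) and the transversality of the
# η-odd Kummer line hold for that tower from "no `p`-torsion at layer `n`" (+ the generation half)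
# alone (cell `b2b-bsdres`, CLASS-CLOSURE lane, class O10 — x1b GEN 31, class lead; file 4 of the
# series p312958 / p313494 / p314385)

HONEST FRAMING (cell `b2b-bsdres`, run/shared/lean/b2b/bsd-rank1-residual/, verbatim in every
file): the goal of the cell is to DELETE the COMBINATION-SHAPED residual classes of the
Birch–Swinnerton-Dyer formula for ALL analytic-rank `≤ 1` elliptic curves over `ℚ` — "full BSD
formula for every rank `≤ 1` curve in class `C`" assembled STRICTLY from published theorems — so
that the rank-`≤ 1` remainder becomes exactly the CONSTRUCTION-SHAPED classes, which are TYPED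
(missing-input `Prop`s), NOT attempted. This is not "finishing BSD". CLASS-CLOSURE lane: prove
what is provable now; shrink each hard class to its core with data; no claim beyond stated classes;
research routes on CONSTRUCTION-SHAPED X12 / O10; census / instrument output = EVIDENCE / conjecture
items, NEVER a Literature fact; `RESIDUAL-MAP.md` marks change only by signed lines. THIS FILE:
TOOL THEOREMS ONLY (group-index bookkeeping + corollaries over cc-typer-6's `towerSubgroup`,
`towerSignedLocalPointsOfEmb`) — no definition, no named Literature fact, no
Summits-side fact `def`, no `sorry`, axioms standard; Prop. 8.12 ii) (generation half) and Prop. 8.7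
stay HYPOTHESES; nothing is booked; no label / mark / count / sub-cell moves; O10 stays OPEN /
CONSTRUCTION-SHAPED; nothing about `BSD(W, p)` of any pair is claimed.

## What is proved

* §1 (pure group theory) `relIndex_dvd_relIndex_of_le'`: for `B` normal and `L ≤ A`,
  `[L : B ∩ L] ∣ [A : B ∩ A]`; `index_localSubgroupOfEmb_subgroupOf_dvd`: the local pair index
  `[(A)_E : (B)_E ∩ (A)_E]` divides anything `[A : B]` divides (`Subgroup.relIndex_comap`,
  `Subgroup.map_comap_le`).
* §2 `relIndex_towerSubgroup_dvd_pow`: `[Gal(K̄/K₀K_m) : Gal(K̄/K₀K_n)] ∣ p^{n−m}` for `m ≤ n`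
  (`index_layerSubgroup`, `relIndex_mul_index`); **`index_local_towerSubgroup_dvd_pow`**: the local
  layer index `[K_{n,v} : K_{m,v}]` of cc-typer-6's tower divides `p^{n−m}` — the `hidx` hypothesis of
  files 2/3 of this series, DISCHARGED for `U = towerSubgroup κ K₀`.
* §3 Corollaries for `U = towerSubgroup κ K₀` (Kobayashi: `K = ℚ`, `K₀ = ℚ(μ_p)`, `E = ℚ_p`):
  `inf_towerSigned_towerSubgroup_eq_top` — **`E⁺(K_{n,v}) ∩ E⁻(K_{n,v}) = E(K_{−1,v})`** from the single
  hypothesis "no `p`-torsion in `E(K_{n,v})`" (Prop. 8.7); `exists_eq_nsmul_of_pow_nsmul_eq_add_tower`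
  — point-level transversality of the η-odd bottom Kummer line to `E⁻(K_{n,v})` under `hsum`
  (Prop. 8.12 ii) generation half), Prop. 8.7 at layer `n`, `p` odd. (The CLASS-level form for this
  tower is `not_mem_localKummerOverOfEmb_neg_one_of_kummer_generator` of
  `CyclotomicTowerSignedLocalTransverseH1.lean` (p314385) fed with `hidx_towerSubgroup` and
  `towerSubgroup_antitone` — a one-line specialisation, not restated here.)

References: [Kobayashi2003] §2 p. 4, Prop. 8.7 (p. 16), Prop. 8.12 ii) (pp. 17–18), Def. 8.16 and
Lemma 8.17 (p. 19); [SerreGaloisCohomology1997] II.§1.1.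
-/

noncomputable section

open scoped Classical

universe u

namespace Summit.BirchSwinnertonDyer.Rank1Residual.Additive

open Literature.NumberTheory.EllipticCurves Literature.NumberTheory.GaloisRepresentations
  Literature.NumberTheory.EllipticCurves.Kobayashi2003 ZpExtension

/-! ## §1 Index bookkeeping -/

section Index

variable {G : Type*} [Group G]

/-- For `B` normal and `L ≤ A`: `[L : B ∩ L] ∣ [A : B ∩ A]` (`L/(B ∩ L) ↪ A/(B ∩ A)`).
[folklore] -/
theorem relIndex_dvd_relIndex_of_le' (B : Subgroup G) [B.Normal] {L A : Subgroup G} (hLA : L ≤ A) :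
    B.relIndex L ∣ B.relIndex A := by
  rw [← Subgroup.relIndex_subgroupOf hLA]
  exact Subgroup.relIndex_dvd_index_of_normal _ _

variable {K : Type u} [Field K] {E : Type u} [Field E] [Algebra K E]
  (ι : AlgebraicClosure K →ₐ[K] AlgebraicClosure E)

/-- **The local pair index divides the global one**: for `B` normal, the index of
`(B)_E ∩ (A)_E` in `(A)_E` (the multiplier `[L₂,w : L₁,w]` of `localPairTraceOfEmb_apply_of_mem_lower`)
divides every `d` with `[A : B ∩ A] ∣ d` (`(B)_E = B.comap res`, `Subgroup.relIndex_comap`,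
`map res (comap res A) ≤ A`). Serre, *Galois Cohomology*, II.§1.1. [cite: SerreGaloisCohomology1997, II.§1.1] -/
theorem index_localSubgroupOfEmb_subgroupOf_dvd (A B : Subgroup (Field.absoluteGaloisGroup K))
    [B.Normal] {d : ℕ} (hd : B.relIndex A ∣ d) :
    ((localSubgroupOfEmb B ι).subgroupOf (localSubgroupOfEmb A ι)).index ∣ d := by
  change (localSubgroupOfEmb B ι).relIndex (localSubgroupOfEmb A ι) ∣ d
  unfold localSubgroupOfEmb
  rw [Subgroup.relIndex_comap]
  exact (relIndex_dvd_relIndex_of_le' B (Subgroup.map_comap_le _ _)).trans hd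

end Index

/-! ## §2 The tower `Gal(K̄/K₀·K_n^κ)`: layer indices are `p`-powers -/

section Tower

variable {K : Type u} [Field K] {p : ℕ} [Fact p.Prime] (κ : ZpExtension K p)
  (K₀ : Type u) [Field K₀] [Algebra K K₀]

/-- `[Gal(K̄/K_m^κ) : Gal(K̄/K_n^κ)] = p^{n−m}` for `m ≤ n` (`index_layerSubgroup`,
`relIndex_mul_index`). [folklore] -/
theorem relIndex_layerSubgroup_eq_pow {m n : ℕ} (hmn : m ≤ n) :
    (κ.layerSubgroup n).relIndex (κ.layerSubgroup m) = p ^ (n - m) := by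
  have h := Subgroup.relIndex_mul_index (κ.layerSubgroup_antitone hmn)
  rw [κ.index_layerSubgroup, κ.index_layerSubgroup, ← Nat.sub_add_cancel hmn, pow_add,
    Nat.sub_add_cancel hmn] at h
  exact Nat.eq_of_mul_eq_mul_right (pow_pos (Fact.out : p.Prime).pos m) h

/-- **`[Gal(K̄/K₀K_m) : Gal(K̄/K₀K_n)] ∣ p^{n−m}`** for `m ≤ n`:
`towerSubgroup n = layerSubgroup n ⊓ (layerSubgroup m ⊓ Gal(K̄/K₀))`, `inf_relIndex_right`, and
§1 with `B = layerSubgroup n` (normal), `L = towerSubgroup m ≤ A = layerSubgroup m`.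
[cite: Kobayashi2003, §2 p. 4 (the tower K_n)] -/
theorem relIndex_towerSubgroup_dvd_pow {m n : ℕ} (hmn : m ≤ n) :
    (towerSubgroup κ K₀ n).relIndex (towerSubgroup κ K₀ m) ∣ p ^ (n - m) := by
  have hinf : towerSubgroup κ K₀ n = κ.layerSubgroup n ⊓ towerSubgroup κ K₀ m := by
    change κ.layerSubgroup n ⊓ galRange (K := K) K₀ =
      κ.layerSubgroup n ⊓ (κ.layerSubgroup m ⊓ galRange (K := K) K₀)
    rw [← inf_assoc, inf_of_le_left (κ.layerSubgroup_antitone hmn)]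
  have hle : towerSubgroup κ K₀ m ≤ κ.layerSubgroup m := inf_le_left
  rw [hinf, Subgroup.inf_relIndex_right, ← relIndex_layerSubgroup_eq_pow κ hmn]
  exact relIndex_dvd_relIndex_of_le' _ hle

variable {E : Type u} [Field E] [Algebra K E] (ι : AlgebraicClosure K →ₐ[K] AlgebraicClosure E)

/-- **The `hidx` hypothesis DISCHARGED for cc-typer-6's tower**: the local layer index
`[K_{n,v} : K_{m,v}] = [(towerSubgroup m)_E : (towerSubgroup n)_E ∩ (towerSubgroup m)_E]` divides
`p^{n−m}`, for `Gal(K̄/K₀)` normal. [cite: Kobayashi2003, §2 p. 4 (the tower K_n)] -/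
theorem index_local_towerSubgroup_dvd_pow [(galRange (K := K) K₀).Normal] {m n : ℕ} (hmn : m ≤ n) :
    ((localSubgroupOfEmb (towerSubgroup κ K₀ n) ι).subgroupOf
        (localSubgroupOfEmb (towerSubgroup κ K₀ m) ι)).index ∣ p ^ (n - m) :=
  index_localSubgroupOfEmb_subgroupOf_dvd ι _ _ (relIndex_towerSubgroup_dvd_pow κ K₀ hmn)

/-- The `hidx` hypothesis of files 2/3 in its literal shape, for `U = towerSubgroup κ K₀`.
[cite: Kobayashi2003, §2 p. 4] -/
theorem hidx_towerSubgroup [(galRange (K := K) K₀).Normal] (n : ℕ) :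
    ∀ m ≤ n, ∃ k : ℕ, ((localSubgroupOfEmb (towerSubgroup κ K₀ n) ι).subgroupOf
      (localSubgroupOfEmb (towerSubgroup κ K₀ m) ι)).index ∣ p ^ k :=
  fun _ hm => ⟨_, index_local_towerSubgroup_dvd_pow κ K₀ ι hm⟩

end Tower

/-! ## §3 Corollaries for cc-typer-6's tower `towerSubgroup κ K₀` -/

section Corollaries

variable {K : Type u} [Field K] [NumberField K] {p : ℕ} [Fact p.Prime] (κ : ZpExtension K p)
  (K₀ : Type u) [Field K₀] [NumberField K₀] [Algebra K K₀] [(galRange (K := K) K₀).Normal]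
  {E : Type u} [Field E] [Algebra K E] (ι : AlgebraicClosure K →ₐ[K] AlgebraicClosure E)
  (W : WeierstrassCurve K)

/-- **Prop. 8.12 ii), first identity, for the tower `K₀·K_n^κ`, from Prop. 8.7 alone**:
`E⁺(K_{n,v}) ⊓ E⁻(K_{n,v}) = E(K_{−1,v})` as soon as `E(K_{n,v})` has no `p`-torsion.
[cite: Kobayashi2003, Prop. 8.12 ii) (pp. 17–18), Def. 8.16 (p. 19), Prop. 8.7 (p. 16)] -/
theorem inf_towerSigned_towerSubgroup_eq_top (n : ℕ)
    (htors : ∀ Q ∈ localFixedPointsOfEmb ι W (towerSubgroup κ K₀ n), p • Q = 0 → Q = 0) :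
    towerSignedLocalPointsOfEmb (towerSubgroup κ K₀) ι W 1 n ⊓
        towerSignedLocalPointsOfEmb (towerSubgroup κ K₀) ι W (-1) n =
      localFixedPointsOfEmb ι W ⊤ :=
  inf_towerSignedLocalPointsOfEmb_eq_top (towerSubgroup κ K₀) ι W n htors (hidx_towerSubgroup κ K₀ ι n)

/-- **Point-level transversality for the tower `K₀·K_n^κ`**: an η-odd bottom point `P ∈ E(K_{0,v})`
(`τ • P = −P`) with `p^j • P = M + p^{j+1} • Q`, `M ∈ E⁻(K_{n,v})`, `Q ∈ E(K_{n,v})`, is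
`p`-divisible in `E(K_{0,v})` — hypotheses: `hsum` (Prop. 8.12 ii) generation half at layer `n`),
no `p`-torsion in `E(K_{n,v})` (Prop. 8.7), `p` odd. [cite: Kobayashi2003, Prop. 8.12 ii) (pp. 17–18), Lemma 8.17 (p. 19), Prop. 8.7 (p. 16)] -/
theorem exists_eq_nsmul_of_pow_nsmul_eq_add_tower (n : ℕ)
    (hsum : localFixedPointsOfEmb ι W (towerSubgroup κ K₀ n) ≤
      towerSignedLocalPointsOfEmb (towerSubgroup κ K₀) ι W 1 n ⊔
        towerSignedLocalPointsOfEmb (towerSubgroup κ K₀) ι W (-1) n)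
    (hodd : Odd p)
    (htors : ∀ Q ∈ localFixedPointsOfEmb ι W (towerSubgroup κ K₀ n), p • Q = 0 → Q = 0)
    {P : localPoints W E} (hP : P ∈ localFixedPointsOfEmb ι W (towerSubgroup κ K₀ 0))
    {τ : Field.absoluteGaloisGroup E} (hτ : τ • P = -P) (j : ℕ)
    {M Q : localPoints W E} (hM : M ∈ towerSignedLocalPointsOfEmb (towerSubgroup κ K₀) ι W (-1) n)
    (hQ : Q ∈ localFixedPointsOfEmb ι W (towerSubgroup κ K₀ n)) (hPMQ : p ^ j • P = M + p ^ (j + 1) • Q) :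
    ∃ S ∈ localFixedPointsOfEmb ι W (towerSubgroup κ K₀ 0), P = p • S :=
  exists_mem_zero_eq_nsmul_of_pow_nsmul_eq_add' (towerSubgroup κ K₀) ι W (towerSubgroup_antitone κ K₀)
    n hsum hodd htors (hidx_towerSubgroup κ K₀ ι n) hP hτ j hM hQ hPMQ

end Corollaries

end Summit.BirchSwinnertonDyer.Rank1Residual.Additive

end
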